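import Mathlib.Topology.Homotopy.Contractible
import Mathlib.Topology.Homotopy.Equiv
import Mathlib.Topology.Piecewise
import Mathlib.Topology.Order.ProjIcc
import HarnessLib

/-!
# A space covered by two closed contractible pieces meeting along a collared contractible subspace is contractible

Topic `Literature/AlgebraicTopology/Homotopy`. Elementary homotopy theory, absent from Mathlib
(which has `ContractibleSpace`, homotopies and homotopy equivalences, but no deformation
retractions and no homotopy extension property), needed for the boundary connected sum of
contractible manifolds (`Literature/Topology/FourManifolds/BoundaryConnectedSum.lean`, the named
fact `Literature.Topology.FourManifolds.contractibleSpace_of_isOpenGluing_boundaryConnectedSumRel` under Matveyev's cork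
decomposition): Matveyev's new corks `W₁ ♮ W₂` are contractible.

**Theorem** (`Literature.AlgebraicTopology.Homotopy.CollaredCover.contractibleSpace`). Let `P = X' ∪ Y'` be the union of two closed
subsets, let `A` be a space and `κ : A × [0, 1] → P` a closed embedding into `Y'` with
`κ (A × {0}) = X' ∩ Y'` and `Y' ∖ κ (A × [0, 1))` closed (a *collar* of `X' ∩ Y'` in `Y'`). If
`X'`, `Y'` and `A` are contractible, then `P` is contractible.

This is the special case, for collared pairs, of the classical facts "if `(Z, A)` has the homotopy
extension property and the inclusion `A ↪ Z` is a homotopy equivalence then `A` is a strong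
deformation retract of `Z`" (Hatcher, *Algebraic Topology* (2002), Prop. 0.19 and Cor. 0.20;
collared pairs have the HEP, Hatcher Example 0.15) and "a strong deformation retraction of
`Y'` onto `X' ∩ Y'` extends by the identity of `X'`". For collars the deformation retraction can
be written down directly, which is what this file does; no HEP machinery is developed.

**Proof.** Work in `Z := Y'`, with the inclusion `i : A → Z`, `i a = κ (a, 0)`, and contractions
`C : [0,1] × Z → Z` of `Z` to `z₀` and `d : [0,1] × A → A` of `A` to `a₀` (`C₀ = id`,
`C₁ = z₀`, `d₀ = id`, `d₁ = a₀`). All maps below are defined by the collar coordinates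
`(a, s) ↦ κ (a, s)` on `N := κ (A × [0,1])` and separately on the closed set
`C := Z ∖ κ (A × [0,1))`, the two definitions agreeing on `N ∩ C = κ (A × {1})`
(`CollaredCover.glue`, continuity by pasting closed sets).
1. *A retraction* `r : Z → A`: `r (κ (a, s)) = d (2s - 1, a)` (so `r = a` for `s ≤ 1/2`),
   `r = a₀` on `C`. Then `r ∘ i = id`.
2. *A homotopy* `k_t : Z → Z` from `i ∘ r` to `id` whose track on `A` is a loop of the form
   `ω · ω̄`: `k_t = C_{2t} ∘ i ∘ r` for `t ≤ 1/2` and `k_t = C_{2-2t}` for `t ≥ 1/2`; on `i a` it is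
   `C_{m(t)} (i a)` with `m t = min (2t) (2 - 2t)`.
3. *Straightening the track using the collar*: with `λ s = max 0 (min (2s - 1/2) s)` (so
   `λ = 0` on `[0, 1/4]`, `λ (1/2) = 1/2`, `λ = id` on `[1/2, 1]`) put, for `t ∈ [0, 1]`,
   `K_t (κ (a, s)) = C_{4 s · m(t)} (i a)` for `s ≤ 1/4`, `K_t (κ (a, s)) = k_t (κ (a, λ s))` for
   `s ≥ 1/4`, and `K_t = k_t` on `C`. This is a homotopy from `i ∘ r` to the map
   `E (κ (a, s)) = κ (a, λ s)` (`E = id` on `C`) which is *stationary on `i (A)`*.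
4. `E` is homotopic to `id` rel `i (A)` by `L_t (κ (a, s)) = κ (a, (1 - t) λ s + t s)`.
5. Hence `i ∘ r ≃ id` rel `i (A)`: `A` is a strong deformation retract of `Z = Y'`. Extending the
   concatenated homotopy by the identity on `X'` (they agree on `X' ∩ Y' = i (A)`) gives a
   homotopy on `P` from a map `ρ : P → X'` with `ρ|X' = id` to `id_P`, so `P ≃ X'` is a homotopy
   equivalence (`CollaredCover.homotopyEquivLeft`) and `P` is contractible with `X'`.

## References

* A. Hatcher, *Algebraic Topology*, CUP (2002), Ch. 0: Example 0.15 (collared pairs have the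
  HEP), Prop. 0.19, Cor. 0.20 (deformation retractions from the homotopy extension property).
* T. tom Dieck, *Algebraic Topology*, EMS (2008), §5.1 (cofibrations), Prop. 5.1.10.

## Design notes

* The two closed pieces are `Set`s of `P`; the collar is parametrised by an arbitrary space `A`
  (in the application, a hemisphere parametrising the seam of a boundary connected sum) rather
  than by the subtype `X' ∩ Y'`.
* All homotopies are handled as plain continuous functions `[0,1] × _ → _`
  (`unitInterval`-valued parameters entered through `Set.projIcc`, `Literature.AlgebraicTopology.Homotopy.clampI`); only the final
  statement is packaged as a `ContinuousMap.HomotopyEquiv`.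
* Everything is in namespace `Literature`; no named facts are introduced.
-/

open Set Function Topology
open scoped unitInterval Topology

noncomputable section

namespace Literature.AlgebraicTopology.Homotopy

universe u v

attribute [local instance] Classical.propDecidable

/-! ### §1 Clamping real parameters into `[0, 1]` and contractions -/

section Clamp

/-- The clamp `ℝ → [0, 1]` (`Set.projIcc`). [folklore] -/
def clampI (x : ℝ) : I := Set.projIcc 0 1 zero_le_one x

/-- The clamp is continuous. [folklore] -/
theorem continuous_clampI : Continuous clampI := continuous_projIcc (h := zero_le_one)

/-- The clamp is the identity on `[0, 1]`. [folklore] -/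
theorem clampI_of_mem {x : ℝ} (hx : x ∈ Icc (0 : ℝ) 1) : clampI x = ⟨x, hx⟩ :=
  Set.projIcc_of_mem _ hx

/-- The clamp is the identity on `[0, 1]` (coerced form). [folklore] -/
@[simp] theorem clampI_coe (t : I) : clampI (t : ℝ) = t := Set.projIcc_val _ t

/-- The clamp of a real `≤ 0` is `0`. [folklore] -/
theorem clampI_of_nonpos {x : ℝ} (hx : x ≤ 0) : clampI x = 0 :=
  Subtype.ext (by rw [clampI, Set.projIcc_of_le_left _ hx]; rfl)

/-- The clamp of a real `≥ 1` is `1`. [folklore] -/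
theorem clampI_of_one_le {x : ℝ} (hx : 1 ≤ x) : clampI x = 1 :=
  Subtype.ext (by rw [clampI, Set.projIcc_of_right_le _ hx]; rfl)

/-- `clampI 0 = 0`. [folklore] -/
@[simp] theorem clampI_zero : clampI 0 = 0 := clampI_of_nonpos le_rfl

/-- `clampI 1 = 1`. [folklore] -/
@[simp] theorem clampI_one : clampI 1 = 1 := clampI_of_one_le le_rfl

/-- The value of the clamp on `[0, 1]`. [folklore] -/
theorem coe_clampI_of_mem {x : ℝ} (hx : x ∈ Icc (0 : ℝ) 1) : (clampI x : ℝ) = x := by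
  rw [clampI_of_mem hx]

/-- **A contraction of a contractible space** as a continuous map `[0,1] × X → X` from the
identity to a constant (Mathlib's `id_nullhomotopic`, unbundled). [folklore] -/
theorem exists_contraction (X : Type*) [TopologicalSpace X] [ContractibleSpace X] :
    ∃ (x₀ : X) (H : C(I × X, X)), (∀ x, H (0, x) = x) ∧ ∀ x, H (1, x) = x₀ := by
  obtain ⟨x₀, ⟨F⟩⟩ := id_nullhomotopic X
  exact ⟨x₀, F.toContinuousMap, fun x => by simp, fun x => by simp⟩

/-- The centre of a chosen contraction of a contractible space. [folklore] -/
def ctrCenter (X : Type*) [TopologicalSpace X] [ContractibleSpace X] : X :=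
  (exists_contraction X).choose

/-- A chosen contraction `C : [0,1] × X → X` of a contractible space: `C (0, x) = x`,
`C (1, x) = ctrCenter X`. [folklore] -/
def ctrMap (X : Type*) [TopologicalSpace X] [ContractibleSpace X] : C(I × X, X) :=
  (exists_contraction X).choose_spec.choose

/-- `C (0, x) = x`. [folklore] -/
@[simp] theorem ctrMap_zero {X : Type*} [TopologicalSpace X] [ContractibleSpace X] (x : X) :
    ctrMap X (0, x) = x :=
  (exists_contraction X).choose_spec.choose_spec.1 x

/-- `C (1, x) = ctrCenter X`. [folklore] -/
@[simp] theorem ctrMap_one {X : Type*} [TopologicalSpace X] [ContractibleSpace X] (x : X) :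
    ctrMap X (1, x) = ctrCenter X :=
  (exists_contraction X).choose_spec.choose_spec.2 x

/-- A contractible space is nonempty. [folklore] -/
theorem nonempty_of_contractibleSpace (X : Type*) [TopologicalSpace X] [ContractibleSpace X] :
    Nonempty X :=
  ⟨ctrCenter X⟩

/-- The profile `m t = min (2t) (2 - 2t)` of the loop `ω · ω̄`. [folklore] -/
def loopProfile (t : ℝ) : ℝ := min (2 * t) (2 - 2 * t)

/-- The collar reparametrisation `λ s = min (2s - 1/2) s` (before clamping): `≤ 0` on
`[0, 1/4]`, `= 2s - 1/2` on `[1/4, 1/2]`, `= s` on `[1/2, 1]`. [folklore] -/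
def collarReparam (s : ℝ) : ℝ := min (2 * s - 1 / 2) s

/-- `m` is continuous. [folklore] -/
theorem continuous_loopProfile : Continuous loopProfile :=
  (continuous_const.mul continuous_id).min (continuous_const.sub (continuous_const.mul continuous_id))

/-- `λ` is continuous. [folklore] -/
theorem continuous_collarReparam : Continuous collarReparam :=
  ((continuous_const.mul continuous_id).sub continuous_const).min continuous_id

/-- `m 0 = 0`. [folklore] -/
@[simp] theorem loopProfile_zero : loopProfile 0 = 0 := by simp [loopProfile]

/-- `m 1 = 0`. [folklore] -/
@[simp] theorem loopProfile_one : loopProfile 1 = 0 := by norm_num [loopProfile]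

/-- `m t = 2t` for `t ≤ 1/2`. [folklore] -/
theorem loopProfile_of_le {t : ℝ} (ht : t ≤ 1 / 2) : loopProfile t = 2 * t := by
  unfold loopProfile; exact min_eq_left (by linarith)

/-- `m t = 2 - 2t` for `1/2 ≤ t`. [folklore] -/
theorem loopProfile_of_ge {t : ℝ} (ht : 1 / 2 ≤ t) : loopProfile t = 2 - 2 * t := by
  unfold loopProfile; exact min_eq_right (by linarith)

/-- `λ s ≤ 0` for `s ≤ 1/4`. [folklore] -/
theorem collarReparam_nonpos {s : ℝ} (hs : s ≤ 1 / 4) : collarReparam s ≤ 0 := by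
  unfold collarReparam; exact (min_le_left _ _).trans (by linarith)

/-- `λ s = 2s - 1/2` for `s ≤ 1/2`. [folklore] -/
theorem collarReparam_of_le {s : ℝ} (hs : s ≤ 1 / 2) : collarReparam s = 2 * s - 1 / 2 := by
  unfold collarReparam; exact min_eq_left (by linarith)

/-- `λ s = s` for `1/2 ≤ s`. [folklore] -/
theorem collarReparam_of_ge {s : ℝ} (hs : 1 / 2 ≤ s) : collarReparam s = s := by
  unfold collarReparam; exact min_eq_right (by linarith)

/-- `λ s ≤ s`. [folklore] -/
theorem collarReparam_le (s : ℝ) : collarReparam s ≤ s := min_le_right _ _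

/-- `clampI (λ s) = 0` for `s ≤ 1/4`. [folklore] -/
theorem clampI_collarReparam_of_le {s : ℝ} (hs : s ≤ 1 / 4) : clampI (collarReparam s) = 0 :=
  clampI_of_nonpos (collarReparam_nonpos hs)

/-- `clampI (λ 1) = 1`. [folklore] -/
@[simp] theorem clampI_collarReparam_one : clampI (collarReparam 1) = 1 := by
  rw [collarReparam_of_ge (by norm_num)]; exact clampI_one

/-- `clampI (λ s) = s` for `1/2 ≤ s` (`s ∈ [0, 1]`). [folklore] -/
theorem clampI_collarReparam_of_ge {s : I} (hs : 1 / 2 ≤ (s : ℝ)) : clampI (collarReparam s) = s := by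
  rw [collarReparam_of_ge hs, clampI_coe]

/-- `2 λ s - 1 ≤ 0` whenever `s ≤ 1/2` (after clamping `λ`). [folklore] -/
theorem two_mul_clampI_collarReparam_sub_one_nonpos {s : ℝ} (hs : s ≤ 1 / 2) :
    2 * (clampI (collarReparam s) : ℝ) - 1 ≤ 0 := by
  by_cases h : s ≤ 1 / 4
  · rw [clampI_collarReparam_of_le h]
    norm_num
  · have h' : 1 / 4 < s := not_le.1 h
    rw [collarReparam_of_le hs, coe_clampI_of_mem ⟨by linarith, by linarith⟩]
    linarith

end Clamp

/-! ### §2 Collared closed covers -/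

/-- **A closed cover `P = X' ∪ Y'` with a collar of `X' ∩ Y'` in `Y'`.** The pieces `left = X'`,
`right = Y'` are closed with union `P`; `collar : A × [0, 1] → P` is a closed embedding into `Y'`
whose bottom `collar (A × {0})` is exactly `X' ∩ Y'`, and the part of `Y'` beyond the open collar
`collar (A × [0, 1))` is closed. (Hatcher, *Algebraic Topology* (2002), Ch. 0, Example 0.15,
"collar neighbourhoods"; the datum needed to deform `Y'` onto `X' ∩ Y'` by explicit formulas.)
[folklore] -/
structure CollaredCover (P : Type u) [TopologicalSpace P] (A : Type v) [TopologicalSpace A] where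
  /-- The first closed piece `X'`. -/
  left : Set P
  /-- The second closed piece `Y'` (the one carrying the collar). -/
  right : Set P
  /-- `X'` is closed. -/
  isClosed_left : IsClosed left
  /-- `Y'` is closed. -/
  isClosed_right : IsClosed right
  /-- `P = X' ∪ Y'`. -/
  union_eq : left ∪ right = univ
  /-- The collar `A × [0, 1] → P`. -/
  collar : A × I → P
  /-- The collar is a closed embedding. -/
  isClosedEmbedding_collar : IsClosedEmbedding collar
  /-- The collar lies in `Y'`. -/
  collar_mem_right : ∀ q, collar q ∈ right
  /-- The bottom of the collar lies in `X'`. -/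
  collar_zero_mem_left : ∀ a, collar (a, 0) ∈ left
  /-- Every point of `X' ∩ Y'` is a bottom point of the collar. -/
  exists_collar_zero_eq : ∀ p ∈ left ∩ right, ∃ a, collar (a, 0) = p
  /-- `Y'` minus the open collar `collar (A × [0, 1))` is closed. -/
  isClosed_right_diff : IsClosed (right \ collar '' {q | q.2 < 1})

namespace CollaredCover

variable {P : Type u} [TopologicalSpace P] {A : Type v} [TopologicalSpace A]
  (c : CollaredCover P A)

/-! #### The collar inside `Y'` and its inverse -/

/-- The collar as a map into the closed piece `Y'`. [folklore] -/
def collarR (q : A × I) : c.right := ⟨c.collar q, c.collar_mem_right q⟩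

/-- The inclusion `i : A → Y'`, `a ↦ collar (a, 0)`. [folklore] -/
def incl (a : A) : c.right := c.collarR (a, 0)

/-- Unfolding of `collarR`. [folklore] -/
@[simp] theorem coe_collarR (q : A × I) : (c.collarR q : P) = c.collar q := rfl

/-- Unfolding of `incl`. [folklore] -/
@[simp] theorem coe_incl (a : A) : (c.incl a : P) = c.collar (a, 0) := rfl

/-- `incl a = collarR (a, 0)`. [folklore] -/
theorem incl_eq (a : A) : c.incl a = c.collarR (a, 0) := rfl

/-- `collarR` is continuous. [folklore] -/
theorem continuous_collarR : Continuous c.collarR :=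
  c.isClosedEmbedding_collar.continuous.subtype_mk _

/-- `incl` is continuous. [folklore] -/
theorem continuous_incl : Continuous c.incl :=
  c.continuous_collarR.comp (Continuous.prodMk_left 0)

/-- `collarR` is injective. [folklore] -/
theorem collarR_injective : Injective c.collarR := fun _ _ h =>
  c.isClosedEmbedding_collar.injective (congrArg Subtype.val h)

/-- A point of `Y'` in the range of the collar but not in the open collar is a top point
`collar (a, 1)`. [folklore] -/
theorem exists_eq_collarR_one {z : c.right} (hz : (z : P) ∈ range c.collar)
    (hz' : (z : P) ∉ c.collar '' {q | q.2 < 1}) : ∃ a, z = c.collarR (a, 1) := by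
  obtain ⟨⟨a, s⟩, hq⟩ := hz
  have hs : s = 1 := by
    by_contra h
    exact hz' ⟨(a, s), lt_of_le_of_ne le_top h, hq⟩
  subst hs
  exact ⟨a, Subtype.ext hq.symm⟩

/-- Every point of `Y'` is on the collar or off the open collar (case analysis for pasted maps).
[folklore] -/
theorem collarR_or_not_mem (z : c.right) :
    (∃ q, z = c.collarR q) ∨ (z : P) ∉ c.collar '' {q | q.2 < 1} := by
  by_cases h : (z : P) ∈ range c.collar
  · obtain ⟨q, hq⟩ := h
    exact Or.inl ⟨q, Subtype.ext hq.symm⟩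
  · exact Or.inr fun ⟨q, _, hq⟩ => h ⟨q, hq⟩

variable [Nonempty A]

/-- A total inverse of the collar (junk off its range). [folklore] -/
def collarInv (p : P) : A × I :=
  if h : p ∈ range c.collar then c.isClosedEmbedding_collar.isEmbedding.toHomeomorph.symm ⟨p, h⟩
  else (Classical.arbitrary A, 0)

/-- `collarInv ∘ collar = id`. [folklore] -/
@[simp] theorem collarInv_collar (q : A × I) : c.collarInv (c.collar q) = q := by
  rw [collarInv, dif_pos (mem_range_self q)]
  exact c.isClosedEmbedding_collar.isEmbedding.toHomeomorph_symm_apply q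

/-- `collarInv` is continuous on the range of the collar. [folklore] -/
theorem continuousOn_collarInv : ContinuousOn c.collarInv (range c.collar) := by
  rw [continuousOn_iff_continuous_restrict]
  have h : (range c.collar).restrict c.collarInv =
      c.isClosedEmbedding_collar.isEmbedding.toHomeomorph.symm := by
    funext ⟨p, hp⟩
    simp only [restrict_apply, collarInv, dif_pos hp]
  rw [h]
  exact (Homeomorph.continuous _)

/-! #### Pasting along the collar -/

section Glue

variable {T : Type*} {W : Type*}

/-- **Pasting a map given in collar coordinates with a map given on `Y'`**: `F₁ t (a, s)` at the
collar point `collar (a, s)`, `F₂ t z` off the range of the collar (with a parameter `t`).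
[folklore] -/
def glue (F₁ : T → A × I → W) (F₂ : T → c.right → W) (t : T) (z : c.right) : W :=
  if (z : P) ∈ range c.collar then F₁ t (c.collarInv z) else F₂ t z

variable {F₁ : T → A × I → W} {F₂ : T → c.right → W}

/-- On the collar the pasted map is `F₁`. [folklore] -/
@[simp] theorem glue_collarR (t : T) (q : A × I) : c.glue F₁ F₂ t (c.collarR q) = F₁ t q := by
  simp [glue]

/-- On `incl a` the pasted map is `F₁ t (a, 0)`. [folklore] -/
@[simp] theorem glue_incl (t : T) (a : A) : c.glue F₁ F₂ t (c.incl a) = F₁ t (a, 0) :=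
  c.glue_collarR t (a, 0)

/-- Off the open collar the pasted map is `F₂`, provided `F₁` and `F₂` agree on the top of the
collar. [folklore] -/
theorem glue_of_not_mem (hagree : ∀ t a, F₁ t (a, 1) = F₂ t (c.collarR (a, 1))) (t : T)
    {z : c.right} (hz : (z : P) ∉ c.collar '' {q | q.2 < 1}) : c.glue F₁ F₂ t z = F₂ t z := by
  by_cases h : (z : P) ∈ range c.collar
  · obtain ⟨a, rfl⟩ := c.exists_eq_collarR_one h hz
    rw [glue_collarR, hagree]
  · simp [glue, h]

variable [TopologicalSpace T] [TopologicalSpace W]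

/-- **The pasted map is jointly continuous** when `F₁`, `F₂` are and agree on the top of the
collar: the range of the collar and `Y' ∖ collar (A × [0,1))` are closed and cover `Y'`.
[folklore] -/
theorem continuous_glue (h₁ : Continuous fun p : T × (A × I) => F₁ p.1 p.2)
    (h₂ : Continuous fun p : T × c.right => F₂ p.1 p.2)
    (hagree : ∀ t a, F₁ t (a, 1) = F₂ t (c.collarR (a, 1))) :
    Continuous fun p : T × c.right => c.glue F₁ F₂ p.1 p.2 := by
  have hS : IsClosed {p : T × c.right | ((p.2 : c.right) : P) ∈ range c.collar} :=
    c.isClosedEmbedding_collar.isClosed_range.preimage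
      (continuous_subtype_val.comp continuous_snd)
  have hS' : IsClosed {p : T × c.right | ((p.2 : c.right) : P) ∈ c.right \ c.collar '' {q | q.2 < 1}} :=
    c.isClosed_right_diff.preimage (continuous_subtype_val.comp continuous_snd)
  apply continuous_if
  · rintro ⟨t, z⟩ hfr
    have hz : (z : P) ∈ range c.collar := by
      have := (frontier_subset_closure (s := {p : T × c.right | ((p.2 : c.right) : P) ∈
        range c.collar})) hfr
      rwa [hS.closure_eq] at this
    have hz' : (z : P) ∉ c.collar '' {q | q.2 < 1} := by
      have hsub : {p : T × c.right | ((p.2 : c.right) : P) ∈ range c.collar}ᶜ ⊆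
          {p : T × c.right | ((p.2 : c.right) : P) ∈ c.right \ c.collar '' {q | q.2 < 1}} := by
        rintro ⟨t', z'⟩ hp
        exact ⟨z'.2, fun ⟨q, _, hq⟩ => hp ⟨q, hq⟩⟩
      have hfr' := hfr
      rw [frontier_eq_closure_inter_closure] at hfr'
      have := (closure_mono hsub) hfr'.2
      rw [hS'.closure_eq] at this
      exact this.2
    obtain ⟨a, rfl⟩ := c.exists_eq_collarR_one hz hz'
    show F₁ t (c.collarInv (c.collar (a, 1))) = F₂ t (c.collarR (a, 1))
    rw [collarInv_collar, hagree]
  · rw [hS.closure_eq]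
    refine h₁.comp_continuousOn (continuousOn_fst.prodMk ?_)
    exact c.continuousOn_collarInv.comp (continuous_subtype_val.comp continuous_snd).continuousOn
      fun p hp => hp
  · exact h₂.continuousOn

end Glue

/-! #### The end map `E` and the homotopy `L : E ≃ id` rel `i (A)` (collar only) -/

/-- **The end map `E`** of `K`: `E (collar (a, s)) = collar (a, λ s)`, `E = id` off the collar.
[folklore] -/
def eFun : c.right → c.right :=
  c.glue (T := Unit) (fun _ q => c.collarR (q.1, clampI (collarReparam q.2))) (fun _ z => z) ()


/-- **The homotopy `L`** from `E` to `id`: `L_t (collar (a, s)) = collar (a, (1 - t) λ s + t s)`,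
`L = id` off the collar. [folklore] -/
def bigL : I → c.right → c.right :=
  c.glue (fun t q => c.collarR (q.1, clampI ((1 - (t : ℝ)) * (clampI (collarReparam q.2) : ℝ) + t * q.2)))
    (fun _ z => z)

omit [Nonempty A] in
/-- The two definitions of `L` agree on the top of the collar. [folklore] -/
theorem bigL_agree (t : I) (a : A) :
    c.collarR (a, clampI ((1 - (t : ℝ)) * (clampI (collarReparam (1 : I)) : ℝ) + t * (1 : I))) =
      c.collarR (a, 1) := by
  simp

/-- `L` is jointly continuous. [folklore] -/
theorem continuous_bigL : Continuous fun p : I × c.right => c.bigL p.1 p.2 := by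
  refine c.continuous_glue ?_ continuous_snd c.bigL_agree
  refine c.continuous_collarR.comp ((continuous_fst.comp continuous_snd).prodMk
    (continuous_clampI.comp ?_))
  exact ((continuous_const.sub (continuous_subtype_val.comp continuous_fst)).mul
    (continuous_subtype_val.comp (continuous_clampI.comp (continuous_collarReparam.comp
      (continuous_subtype_val.comp (continuous_snd.comp continuous_snd)))))).add
    ((continuous_subtype_val.comp continuous_fst).mul
      (continuous_subtype_val.comp (continuous_snd.comp continuous_snd)))

/-- `L_0 = E`. [folklore] -/
theorem bigL_zero (z : c.right) : c.bigL 0 z = c.eFun z := by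
  rcases c.collarR_or_not_mem z with ⟨⟨a, s⟩, rfl⟩ | hz
  · rw [bigL, glue_collarR, eFun, glue_collarR]
    simp
  · rw [bigL, c.glue_of_not_mem c.bigL_agree 0 hz, eFun, c.glue_of_not_mem (fun _ a => by simp) () hz]

/-- `L_1 = id`. [folklore] -/
theorem bigL_one (z : c.right) : c.bigL 1 z = z := by
  rcases c.collarR_or_not_mem z with ⟨⟨a, s⟩, rfl⟩ | hz
  · rw [bigL, glue_collarR]
    simp
  · rw [bigL, c.glue_of_not_mem c.bigL_agree 1 hz]

/-- `L` is stationary on `i (A)`. [folklore] -/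
theorem bigL_incl (t : I) (a : A) : c.bigL t (c.incl a) = c.incl a := by
  rw [bigL, glue_incl, incl_eq]
  congr 2
  rw [clampI_collarReparam_of_le (by norm_num)]
  simp

section Deform

variable [ContractibleSpace A]

/-! #### Step 1: the retraction `r : Y' → A` -/

/-- **The retraction** `r : Y' → A`: `r (collar (a, s)) = d (2s - 1, a)` (`= a` for `s ≤ 1/2`),
`r = a₀` off the collar. [folklore] -/
def retr : c.right → A :=
  c.glue (T := Unit) (fun _ q => ctrMap A (clampI (2 * (q.2 : ℝ) - 1), q.1)) (fun _ _ => ctrCenter A) ()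

/-- `r` is continuous. [folklore] -/
theorem continuous_retr : Continuous c.retr := by
  have h := c.continuous_glue (T := Unit)
    (F₁ := fun _ q => ctrMap A (clampI (2 * (q.2 : ℝ) - 1), q.1)) (F₂ := fun _ _ => ctrCenter A)
    ((ctrMap A).continuous.comp ((continuous_clampI.comp (((continuous_const.mul
      (continuous_subtype_val.comp (continuous_snd.comp continuous_snd))).sub
      continuous_const))).prodMk (continuous_fst.comp continuous_snd)))
    continuous_const (fun _ a => by norm_num)
  exact h.comp (Continuous.prodMk_right ())

/-- `r (collar (a, s)) = a` for `s ≤ 1/2`. [folklore] -/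
theorem retr_collarR_of_le (a : A) {s : I} (hs : (s : ℝ) ≤ 1 / 2) :
    c.retr (c.collarR (a, s)) = a := by
  rw [retr, glue_collarR, clampI_of_nonpos (by linarith), ctrMap_zero]

/-- `r ∘ i = id`. [folklore] -/
@[simp] theorem retr_incl (a : A) : c.retr (c.incl a) = a :=
  c.retr_collarR_of_le a (by simp)

/-- `r (collar (a, s)) = d (2s - 1, a)` in general. [folklore] -/
theorem retr_collarR (a : A) (s : I) :
    c.retr (c.collarR (a, s)) = ctrMap A (clampI (2 * (s : ℝ) - 1), a) := by
  rw [retr, glue_collarR]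

variable [ContractibleSpace c.right]

/-! #### Step 2: the homotopy `k` from `i ∘ r` to `id` with track `ω · ω̄` -/

/-- **The homotopy `k`**: `k_t = C_{2t} ∘ i ∘ r` for `t ≤ 1/2`, `k_t = C_{2 - 2t}` for `t ≥ 1/2`.
[folklore] -/
def kFun (t : I) (z : c.right) : c.right :=
  if (t : ℝ) ≤ 1 / 2 then ctrMap c.right (clampI (2 * t), c.incl (c.retr z))
  else ctrMap c.right (clampI (2 - 2 * t), z)

/-- `k` is jointly continuous. [folklore] -/
theorem continuous_kFun : Continuous fun p : I × c.right => c.kFun p.1 p.2 := by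
  refine Continuous.if_le ?_ ?_ (continuous_subtype_val.comp continuous_fst) continuous_const ?_
  · exact (ctrMap c.right).continuous.comp ((continuous_clampI.comp (continuous_const.mul
      (continuous_subtype_val.comp continuous_fst))).prodMk
      (c.continuous_incl.comp (c.continuous_retr.comp continuous_snd)))
  · exact (ctrMap c.right).continuous.comp ((continuous_clampI.comp (continuous_const.sub
      (continuous_const.mul (continuous_subtype_val.comp continuous_fst)))).prodMk continuous_snd)
  · rintro ⟨t, z⟩ (ht : (t : ℝ) = 1 / 2)
    simp only [ht]
    norm_num

/-- `k_0 = i ∘ r`. [folklore] -/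
@[simp] theorem kFun_zero (z : c.right) : c.kFun 0 z = c.incl (c.retr z) := by
  simp [kFun]

/-- `k_1 = id`. [folklore] -/
@[simp] theorem kFun_one (z : c.right) : c.kFun 1 z = z := by
  rw [kFun, if_neg (by norm_num)]
  norm_num

/-- The track of `k` on `i a` is `C_{m(t)} (i a)`. [folklore] -/
theorem kFun_incl (t : I) (a : A) : c.kFun t (c.incl a) = ctrMap c.right (clampI (loopProfile t), c.incl a) := by
  unfold kFun
  split_ifs with h
  · rw [retr_incl, loopProfile_of_le h]
  · rw [loopProfile_of_ge (le_of_lt (not_le.1 h))]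

/-! #### Step 3: straightening the track inside the collar -/

/-- **The collar part `G` of the homotopy `K`**: `G_t (a, s) = C_{4 s m(t)} (i a)` for `s ≤ 1/4`
and `G_t (a, s) = k_t (collar (a, λ s))` for `s ≥ 1/4`. [folklore] -/
def gFun (t : I) (q : A × I) : c.right :=
  if (q.2 : ℝ) ≤ 1 / 4 then ctrMap c.right (clampI (4 * q.2 * loopProfile t), c.incl q.1)
  else c.kFun t (c.collarR (q.1, clampI (collarReparam q.2)))

/-- `G` is jointly continuous. [folklore] -/
theorem continuous_gFun : Continuous fun p : I × (A × I) => c.gFun p.1 p.2 := by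
  refine Continuous.if_le ?_ ?_ (continuous_subtype_val.comp (continuous_snd.comp continuous_snd))
    continuous_const ?_
  · exact (ctrMap c.right).continuous.comp ((continuous_clampI.comp ((continuous_const.mul
      (continuous_subtype_val.comp (continuous_snd.comp continuous_snd))).mul
      (continuous_loopProfile.comp (continuous_subtype_val.comp continuous_fst)))).prodMk
      (c.continuous_incl.comp (continuous_fst.comp continuous_snd)))
  · exact c.continuous_kFun.comp (continuous_fst.prodMk (c.continuous_collarR.comp
      ((continuous_fst.comp continuous_snd).prodMk (continuous_clampI.comp (continuous_collarReparam.comp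
        (continuous_subtype_val.comp (continuous_snd.comp continuous_snd)))))))
  · rintro ⟨t, a, s⟩ (hs : (s : ℝ) = 1 / 4)
    simp only [hs, clampI_collarReparam_of_le le_rfl]
    rw [← incl_eq, kFun_incl]
    norm_num

/-- **The homotopy `K`** from `i ∘ r` to `E`, stationary on `i (A)`: `G` on the collar, `k` off
it. [folklore] -/
def bigK : I → c.right → c.right := c.glue c.gFun c.kFun

/-- `G` and `k` agree on the top of the collar. [folklore] -/
theorem gFun_one_eq (t : I) (a : A) : c.gFun t (a, 1) = c.kFun t (c.collarR (a, 1)) := by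
  rw [gFun, if_neg (by norm_num)]
  simp

/-- `K` is jointly continuous. [folklore] -/
theorem continuous_bigK : Continuous fun p : I × c.right => c.bigK p.1 p.2 :=
  c.continuous_glue c.continuous_gFun c.continuous_kFun c.gFun_one_eq

/-- `K_0 = i ∘ r`. [folklore] -/
theorem bigK_zero (z : c.right) : c.bigK 0 z = c.incl (c.retr z) := by
  rcases c.collarR_or_not_mem z with ⟨⟨a, s⟩, rfl⟩ | hz
  · rw [bigK, glue_collarR, gFun]
    split_ifs with h
    · rw [show ((0 : I) : ℝ) = 0 from rfl, loopProfile_zero, mul_zero, clampI_zero, ctrMap_zero,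
        c.retr_collarR_of_le a (by linarith)]
    · rw [kFun_zero, retr_collarR, retr_collarR]
      congr 2
      by_cases h2 : (s : ℝ) ≤ 1 / 2
      · rw [clampI_of_nonpos (two_mul_clampI_collarReparam_sub_one_nonpos h2),
          clampI_of_nonpos (by linarith)]
      · rw [clampI_collarReparam_of_ge (le_of_lt (not_le.1 h2))]
  · rw [bigK, c.glue_of_not_mem c.gFun_one_eq 0 hz, kFun_zero]

/-- `K_1 = E`. [folklore] -/
theorem bigK_one (z : c.right) : c.bigK 1 z = c.eFun z := by
  rcases c.collarR_or_not_mem z with ⟨⟨a, s⟩, rfl⟩ | hz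
  · rw [bigK, glue_collarR, gFun, eFun, glue_collarR]
    split_ifs with h
    · rw [show ((1 : I) : ℝ) = 1 from rfl, loopProfile_one, mul_zero, clampI_zero, ctrMap_zero,
        clampI_collarReparam_of_le h, incl_eq]
    · rw [kFun_one]
  · rw [bigK, c.glue_of_not_mem c.gFun_one_eq 1 hz, kFun_one, eFun,
      c.glue_of_not_mem (fun _ a => by simp) () hz]

/-- `K` is stationary on `i (A)`. [folklore] -/
theorem bigK_incl (t : I) (a : A) : c.bigK t (c.incl a) = c.incl a := by
  rw [bigK, glue_incl, gFun, if_pos (by norm_num)]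
  simp

/-! #### Step 5: the deformation of `Y'` onto `i (A)` and its extension to `P` -/

/-- **The strong deformation retraction of `Y'` onto `i (A)`**: `K` followed by `L`. [folklore] -/
def klFun (t : I) (z : c.right) : c.right :=
  if (t : ℝ) ≤ 1 / 2 then c.bigK (clampI (2 * t)) z else c.bigL (clampI (2 * t - 1)) z

/-- The deformation is jointly continuous. [folklore] -/
theorem continuous_klFun : Continuous fun p : I × c.right => c.klFun p.1 p.2 := by
  refine Continuous.if_le ?_ ?_ (continuous_subtype_val.comp continuous_fst) continuous_const ?_
  · exact c.continuous_bigK.comp ((continuous_clampI.comp (continuous_const.mul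
      (continuous_subtype_val.comp continuous_fst))).prodMk continuous_snd)
  · exact c.continuous_bigL.comp ((continuous_clampI.comp ((continuous_const.mul
      (continuous_subtype_val.comp continuous_fst)).sub continuous_const)).prodMk continuous_snd)
  · rintro ⟨t, z⟩ (ht : (t : ℝ) = 1 / 2)
    simp only [ht]
    norm_num
    rw [bigK_one, bigL_zero]

/-- At time `0` the deformation is `i ∘ r`. [folklore] -/
theorem klFun_zero (z : c.right) : c.klFun 0 z = c.incl (c.retr z) := by
  simp [klFun, bigK_zero]

/-- At time `1` the deformation is the identity. [folklore] -/
theorem klFun_one (z : c.right) : c.klFun 1 z = z := by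
  rw [klFun, if_neg (by norm_num)]
  norm_num
  exact c.bigL_one z

/-- The deformation is stationary on `i (A)`. [folklore] -/
theorem klFun_incl (t : I) (a : A) : c.klFun t (c.incl a) = c.incl a := by
  unfold klFun
  split_ifs
  · exact c.bigK_incl _ a
  · exact c.bigL_incl _ a

/-- **The deformation of `P`**: the deformation of `Y'` extended by the identity on `X'`.
[folklore] -/
def dFun (t : I) (p : P) : P := if h : p ∈ c.right then (c.klFun t ⟨p, h⟩ : P) else p

/-- On `X'` the deformation of `P` is the identity. [folklore] -/
theorem dFun_of_mem_left (t : I) {p : P} (hp : p ∈ c.left) : c.dFun t p = p := by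
  unfold dFun
  split_ifs with h
  · obtain ⟨a, ha⟩ := c.exists_collar_zero_eq p ⟨hp, h⟩
    have : (⟨p, h⟩ : c.right) = c.incl a := Subtype.ext ha.symm
    rw [this, klFun_incl, coe_incl, ha]
  · rfl

/-- At time `1` the deformation of `P` is the identity. [folklore] -/
theorem dFun_one (p : P) : c.dFun 1 p = p := by
  unfold dFun
  split_ifs with h
  · rw [klFun_one]
  · rfl

/-- At time `0` the deformation of `P` lands in `X'`. [folklore] -/
theorem dFun_zero_mem_left (p : P) : c.dFun 0 p ∈ c.left := by
  unfold dFun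
  split_ifs with h
  · rw [klFun_zero, coe_incl]
    exact c.collar_zero_mem_left _
  · have := c.union_eq ▸ mem_univ p
    exact this.resolve_right h

/-- The deformation of `P` is jointly continuous (pasting the closed pieces `[0,1] × Y'` and
`[0,1] × X'`). [folklore] -/
theorem continuous_dFun : Continuous fun x : I × P => c.dFun x.1 x.2 := by
  have hS : IsClosed ((univ : Set I) ×ˢ c.right) := isClosed_univ.prod c.isClosed_right
  have hS' : IsClosed ((univ : Set I) ×ˢ c.left) := isClosed_univ.prod c.isClosed_left
  have h1 : ContinuousOn (fun x : I × P => c.dFun x.1 x.2) ((univ : Set I) ×ˢ c.right) := by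
    rw [continuousOn_iff_continuous_restrict]
    have heq : ((univ : Set I) ×ˢ c.right).restrict (fun x : I × P => c.dFun x.1 x.2) =
        fun x => (c.klFun x.1.1 ⟨x.1.2, x.2.2⟩ : P) := by
      funext ⟨⟨t, p⟩, hx⟩
      simp only [restrict_apply, dFun, dif_pos hx.2]
    rw [heq]
    exact continuous_subtype_val.comp (c.continuous_klFun.comp
      ((continuous_fst.comp continuous_subtype_val).prodMk
        ((continuous_snd.comp continuous_subtype_val).subtype_mk _)))
  have h2 : ContinuousOn (fun x : I × P => c.dFun x.1 x.2) ((univ : Set I) ×ˢ c.left) :=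
    continuousOn_snd.congr fun x hx => c.dFun_of_mem_left x.1 hx.2
  have h := h1.union_of_isClosed h2 hS hS'
  have huniv : (univ : Set I) ×ˢ c.right ∪ (univ : Set I) ×ˢ c.left = univ := by
    rw [← prod_union, union_comm, c.union_eq, univ_prod_univ]
  rw [huniv] at h
  exact continuousOn_univ.1 h

/-- **`P` is homotopy equivalent to its closed piece `X'`** (the other piece `Y'` deformation
retracts onto `X' ∩ Y'`). Hatcher, *Algebraic Topology* (2002), Cor. 0.20 (collared case).
[folklore] -/
def homotopyEquivLeft : ContinuousMap.HomotopyEquiv P c.left where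
  toFun := ⟨fun p => ⟨c.dFun 0 p, c.dFun_zero_mem_left p⟩,
    (c.continuous_dFun.comp (Continuous.prodMk_right 0)).subtype_mk _⟩
  invFun := ⟨Subtype.val, continuous_subtype_val⟩
  left_inv := ⟨{ toFun := fun x => c.dFun x.1 x.2
                 continuous_toFun := c.continuous_dFun
                 map_zero_left := fun p => rfl
                 map_one_left := fun p => c.dFun_one p }⟩
  right_inv := by
    have h : (⟨fun p => ⟨c.dFun 0 p, c.dFun_zero_mem_left p⟩,
        (c.continuous_dFun.comp (Continuous.prodMk_right 0)).subtype_mk _⟩ : C(P, c.left)).comp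
        ⟨Subtype.val, continuous_subtype_val⟩ = ContinuousMap.id c.left := by
      ext x
      exact c.dFun_of_mem_left 0 x.2
    rw [h]

end Deform

omit [Nonempty A] in
/-- **A space covered by two closed contractible pieces, one of which carries a collar of their
(contractible) intersection, is contractible.** Hatcher, *Algebraic Topology* (2002), Ch. 0
(Example 0.15, Cor. 0.20), specialised to collars and proved by explicit formulas. [folklore] -/
theorem contractibleSpace (c : CollaredCover P A) [ContractibleSpace A]
    (hleft : ContractibleSpace c.left) (hright : ContractibleSpace c.right) : ContractibleSpace P := by
  haveI : Nonempty A := nonempty_of_contractibleSpace A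
  exact c.homotopyEquivLeft.contractibleSpace

end CollaredCover

end Literature.AlgebraicTopology.Homotopy
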